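import Mathlib.MeasureTheory.Integral.Bochner.Basic
import Mathlib.MeasureTheory.Measure.GiryMonad
import Mathlib.Topology.Algebra.Support
import Literature.Probability.Percolation.QuadCrossingSpace
import HarnessLib

/-!
# Pivotal points, flip-fair pivotal kernels and flip-extremality on the Schramm–Smirnov space

Topic `Literature/Probability/Percolation`; definition request `defn-FlipFairKernel` (D2 of route
`Summits/CriticalPhenomena/CardyFormulaZ2/Theses/CardyMeckeFlip`, items FlipIdentityZ2 (K1),
FlipErgodicityZ2 (K3), MeckeRigidity (K2)), together with the part of its companion request D1 that
D2 cannot be stated without (the pivotal predicate).  The lattice witness requested under the same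
item (Garban–Pete–Schramm's normalised `ε`-important counting measures for bond-`ℤ²` and the shape
"`M` is their joint subsequential limit") is the sibling file `Z2PivotalMeasure.lean`.

**Sources (held, read).**  C. Garban, G. Pete, O. Schramm, *Pivotal, cluster and interface
measures for critical planar percolation*, JAMS 26 (2013), arXiv:1008.1378, §1.1 and §4.1 (the
normalised counting measures `μ^ρ_η`, `μ^A_η` on pivotal = `ρ`-important points, their scaling
limits as measurable functions of the quad-crossing configuration `ω`), §1 p. 10 (what survives for
bond-`ℤ²` along subsequences); C. Garban, G. Pete, O. Schramm, *The scaling limits of near-critical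
and dynamical percolation*, JEMS 20 (2018), arXiv:1305.5526, §2.6 (`ε`-important points `Piv^ε`,
the pivotal measure `μ^ε(ω)`), §7.1 (cut-off dynamics: the points of a Poisson process of intensity
`μ^ε(ω)(dx) dt` are FLIPPED), §11.1 (Theorem: the dynamical scaling limit is a Markov process
REVERSIBLE w.r.t. the percolation scaling limit), §12.1 Remark (ergodicity open); J. Mecke,
Z. Wahrsch. 9 (1967), Satz 2.3/2.5 and G. Last, M. Penrose, *Lectures on the Poisson process*
(2017), Thm. 4.1 (the Campbell–Mecke integral equation `E ∫ h(η, x) η(dx) = ∫ E h(η + δ_x, x) λ(dx)`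
as a CHARACTERISATION template: an identity between the Campbell measure and its image under a
local modification of the configuration).

**What the route inlines and this file names** (namespace
`Literature.Probability.Percolation.QuadCrossing`, general `D : Set ℂ`; laws `P : Measure ℋ_D`,
kernels `K : ℋ_D → Measure ℂ`, kernel families `M : ℝ → ℋ_D → Measure ℂ`, cutoff `ε ↦ M ε`):

* `QuadConfig.IsPivotalAt S x Q` — **"flipping at `x` toggles `Q`"**, VERBATIM the characterised
  parameter `Piv` of the items: either `Q ∈ S` and no sub-quad of `Q` avoiding a ball around `x`
  (same landing sides) is crossed (open-pivotal), or `Q ∉ S` and for every ball around `x` two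
  crossed sub-quads join `∂₀Q` to the ball and the ball to `∂₂Q` (closed-pivotal).  This is the
  quad-crossing rendering of Garban–Pete–Schramm's pivotal points of the continuum configuration
  (GPS 2013 §1.1: "a point is pivotal for a quad if flipping it changes the crossing"), written
  with sub-quads because `ℋ_D` only knows which quads are crossed.  `isPivotalAt_iff` is `Iff.rfl`
  against the inlined text, so an item hypothesis `∀ S x Q, Piv S x Q ↔ …` is literally
  `∀ S x Q, Piv S x Q ↔ S.IsPivotalAt x Q` and `eq_isPivotalAt_of_forall_iff` turns it into
  `Piv = IsPivotalAt`.  `pivotalPoints S = {x | ∃ Q, S.IsPivotalAt x Q}`.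
* `IsFlipFairKernel P K` — clause **(F)**: the Campbell measure `P(dS) K(S)(dx)` is invariant
  under the pivotal involution, on cylinder test functions:
  `∫∫ φ(x) g({i | Qᵢ ∈ S}) = ∫∫ φ(x) g({i | Qᵢ ∈ S} Δ {i | Piv S x Qᵢ})` for all `n`, quads
  `Q : Fin n → 𝒬_D`, `g : Set (Fin n) → ℝ`, `φ ∈ C_c(ℂ)`.  For the cut-off dynamics of GPS 2018
  §7.1 (flip the points of a Poisson process with intensity `μ^ε(ω)(dx) dt`) this is detailed
  balance, i.e. the reversibility of GPS 2018 §11.1 in Campbell–Mecke form.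
* `IsAdmissibleKernel P M` — clause **(ADM)** minus its last conjunct: each `M ε` measurable
  (`ℋ_D → Measure ℂ`, Giry `σ`-algebra), antitone in the cutoff, locally `P`-integrable, `P`-a.s.
  supported on pivotal points, non-zero; and `IsIsometryEquivariant M` — the last conjunct of
  (ADM), stated on `ℋ_ℂ` where plane isometries act (`QuadConfig.isometry`):
  `M ε (g · S) = g_* (M ε S)`.  `isAdmissibleKernel_and_isIsometryEquivariant_iff` is the inlined
  six-clause conjunction of the items, verbatim.
* `IsFlipExtremal P M` — clause **(EXT)**: `P` is a midpoint-extreme point of the probability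
  laws that are flip-fair for every `M ε`, `ε > 0` (the items' "flip-ergodicity").
* API: `not_isPivotalAt_none` (nothing is pivotal when nothing is crossed), the cone structure of
  flip-fair pairs that does not need integrability (`isFlipFairKernel_zero_measure`,
  `isFlipFairKernel_zero_kernel`, `IsFlipFairKernel.smul_measure`), unfolding lemmas.

**Deliberately NOT here.** (i) The flipped configuration `S^x ∈ ℋ_D` (request D1's `flipAt`: the
closed lower set generated by the toggled quads, an a.s.-defined object needing Schramm–Smirnov
Thm. 1.4 (2)) and with it the two lemmas the request lists as conditional on it — "(F) on
cylinder functions ⇔ invariance on all bounded measurable `h(S, x)`" and "midpoint-extremal ⇔ no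
non-constant bounded flip-invariant density": both are theorems about the flip dynamics, not
definitions, and the second is not printed anywhere for this setting (GPS 2018 §12.1 leaves even
ergodicity open).  (ii) Existence / measurability of limit kernels: route items (K1), not
smuggled in.  (iii) Convexity of the flip-fair laws under `+`: with Bochner integrals it needs the
integrability that (ADM) supplies and is left to the consumer (`integral_add_measure`).

## Mathlib / tree search

`lean search 'IsPivotalAt|flipAt|FlipFair|pivotalKernel|Campbell|Mecke'`: only unrelated `flipAt`s
(Boolean cubes in `Literature/Barriers/QuantumAdvantage`, `Literature/Computability`), the tree's
coordinate pivotality `IsPivotal` / `IsPivotalOn` / `IsPivotalCell` for events of discrete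
configurations (`PercolationEvents.lean`, `PivotalCell.lean` — a different object: pivotality of a
lattice coordinate for an event, used in `Z2PivotalMeasure.lean`'s docstring for comparison), and no
kernel / Campbell-measure notion on `ℋ_D`.  Mathlib: `Measure.instMeasurableSpace` (Giry),
`Measure.map`, Bochner `integral`, `HasCompactSupport`, `IsometryEquiv`; reused, nothing redefined.

## References

* [GarbanPeteSchramm2013Pivotal] C. Garban, G. Pete, O. Schramm, JAMS 26 (2013), arXiv:1008.1378,
  §1.1, §4.1, p. 10.
* [GarbanPeteSchramm2018] C. Garban, G. Pete, O. Schramm, JEMS 20 (2018), arXiv:1305.5526, §2.6,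
  §7.1, §11.1, §12.1.
* [Mecke1967] J. Mecke, Z. Wahrscheinlichkeitstheorie 9 (1967), Satz 2.3, 2.5.
* [LastPenrose2017] G. Last, M. Penrose, Lectures on the Poisson Process (2017), Thm. 4.1.
* [SchrammSmirnov2011] O. Schramm, S. Smirnov, Ann. Probab. 39 (2011), §1.3 (the space `ℋ_D`).
-/

noncomputable section

open Set Filter
open _root_.MeasureTheory _root_.Topology
open scoped ENNReal

namespace Literature.Probability.Percolation

namespace QuadCrossing

variable {D : Set ℂ}

/-! ### Pivotal points of a quad-crossing configuration -/

namespace QuadConfig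

/-- **`x` is pivotal for the quad `Q` in the configuration `S ∈ ℋ_D`** ("flipping at `x` toggles
`Q`"), in the two forms a point can be pivotal: OPEN-pivotal — `Q` is crossed, but no sub-quad of
`Q` whose carrier avoids some ball around `x` and whose landing sides lie in those of `Q` is
crossed; or CLOSED-pivotal — `Q` is not crossed, but for every ball around `x` there are crossed
sub-quads `Q₁` from `∂₀Q` into the ball and `Q₂` from the ball to `∂₂Q`.  This is verbatim the
characterised parameter `Piv S x Q` of route CardyMeckeFlip (the quad-crossing rendering of the
pivotal points of Garban–Pete–Schramm, who flip hexagons: "pivotal for a quad if changing its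
state changes the crossing event"). [cite: GarbanPeteSchramm2013Pivotal, §1.1 and §4.1 (pivotal / ρ-important points)] -/
def IsPivotalAt (S : QuadConfig D) (x : ℂ) (Q : Quad D) : Prop :=
  (Q ∈ S ∧ ∀ ε : ℝ, 0 < ε → ∀ Q' : Quad D, Q'.carrier ⊆ Q.carrier \ Metric.ball x ε →
      Q'.side 0 ⊆ Q.side 0 → Q'.side 2 ⊆ Q.side 2 → Q' ∉ S) ∨
    (Q ∉ S ∧ ∀ ε : ℝ, 0 < ε → ∃ Q₁ Q₂ : Quad D, Q₁ ∈ S ∧ Q₂ ∈ S ∧ Q₁.carrier ⊆ Q.carrier ∧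
      Q₂.carrier ⊆ Q.carrier ∧ Q₁.side 0 ⊆ Q.side 0 ∧ Q₁.side 2 ⊆ Metric.ball x ε ∧
        Q₂.side 0 ⊆ Metric.ball x ε ∧ Q₂.side 2 ⊆ Q.side 2)

/-- `IsPivotalAt` unfolds, by `Iff.rfl`, to the text inlined in the route items (so their
hypothesis `∀ S x Q, Piv S x Q ↔ …` is literally `∀ S x Q, Piv S x Q ↔ S.IsPivotalAt x Q`).
[folklore] -/
theorem isPivotalAt_iff (S : QuadConfig D) (x : ℂ) (Q : Quad D) :
    S.IsPivotalAt x Q ↔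
      (Q ∈ S ∧ ∀ ε : ℝ, 0 < ε → ∀ Q' : Quad D, Q'.carrier ⊆ Q.carrier \ Metric.ball x ε →
          Q'.side 0 ⊆ Q.side 0 → Q'.side 2 ⊆ Q.side 2 → Q' ∉ S) ∨
        (Q ∉ S ∧ ∀ ε : ℝ, 0 < ε → ∃ Q₁ Q₂ : Quad D, Q₁ ∈ S ∧ Q₂ ∈ S ∧ Q₁.carrier ⊆ Q.carrier ∧
          Q₂.carrier ⊆ Q.carrier ∧ Q₁.side 0 ⊆ Q.side 0 ∧ Q₁.side 2 ⊆ Metric.ball x ε ∧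
            Q₂.side 0 ⊆ Metric.ball x ε ∧ Q₂.side 2 ⊆ Q.side 2) :=
  Iff.rfl

/-- A characterised parameter `Piv` of the items IS `IsPivotalAt`: from the items' hypothesis
`∀ S x Q, Piv S x Q ↔ …` (whose right-hand side is `S.IsPivotalAt x Q` by definition) one gets
`Piv = IsPivotalAt`, after which every inlined clause is the named one. [folklore] -/
theorem eq_isPivotalAt_of_forall_iff {Piv : QuadConfig D → ℂ → Quad D → Prop}
    (h : ∀ (S : QuadConfig D) (x : ℂ) (Q : Quad D), Piv S x Q ↔ S.IsPivotalAt x Q) :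
    Piv = fun S x Q => S.IsPivotalAt x Q :=
  funext fun S => funext fun x => funext fun Q => propext (h S x Q)

/-- In the open-pivotal case (`Q ∈ S`) no sub-quad of `Q` with the same landing sides that avoids
a ball around `x` is crossed. [folklore] -/
theorem IsPivotalAt.not_mem_of_mem {S : QuadConfig D} {x : ℂ} {Q : Quad D} (h : S.IsPivotalAt x Q)
    (hQ : Q ∈ S) {ε : ℝ} (hε : 0 < ε) {Q' : Quad D}
    (hcar : Q'.carrier ⊆ Q.carrier \ Metric.ball x ε) (h0 : Q'.side 0 ⊆ Q.side 0)
    (h2 : Q'.side 2 ⊆ Q.side 2) : Q' ∉ S := by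
  rcases h with ⟨-, hopen⟩ | ⟨hQ', -⟩
  · exact hopen ε hε Q' hcar h0 h2
  · exact (hQ' hQ).elim

/-- In the closed-pivotal case (`Q ∉ S`) every ball around `x` is joined to `∂₀Q` and to `∂₂Q` by
crossed sub-quads of `Q`. [folklore] -/
theorem IsPivotalAt.exists_of_not_mem {S : QuadConfig D} {x : ℂ} {Q : Quad D}
    (h : S.IsPivotalAt x Q) (hQ : Q ∉ S) {ε : ℝ} (hε : 0 < ε) :
    ∃ Q₁ Q₂ : Quad D, Q₁ ∈ S ∧ Q₂ ∈ S ∧ Q₁.carrier ⊆ Q.carrier ∧ Q₂.carrier ⊆ Q.carrier ∧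
      Q₁.side 0 ⊆ Q.side 0 ∧ Q₁.side 2 ⊆ Metric.ball x ε ∧ Q₂.side 0 ⊆ Metric.ball x ε ∧
        Q₂.side 2 ⊆ Q.side 2 := by
  rcases h with ⟨hQ', -⟩ | ⟨-, hclosed⟩
  · exact (hQ hQ').elim
  · exact hclosed ε hε

/-- **Nothing is pivotal in the empty configuration** (`QuadConfig.none`, no quad crossed): the
open case needs `Q ∈ S`, the closed case needs crossed sub-quads. [folklore] -/
theorem not_isPivotalAt_none (x : ℂ) (Q : Quad D) : ¬ (none : QuadConfig D).IsPivotalAt x Q := by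
  rintro (⟨hQ, -⟩ | ⟨-, h⟩)
  · exact not_mem_none Q hQ
  · obtain ⟨Q₁, -, hQ₁, -⟩ := h 1 one_pos
    exact not_mem_none Q₁ hQ₁

/-- **The pivotal points of `S`**: the points pivotal for some quad (the support condition of
(ADM) reads `M ε S (pivotalPoints S)ᶜ = 0` a.s.). [cite: GarbanPeteSchramm2013Pivotal, §1.1 (the set of pivotal points)] -/
def pivotalPoints (S : QuadConfig D) : Set ℂ := {x | ∃ Q : Quad D, S.IsPivotalAt x Q}

/-- `mem_pivotalPoints`: structural lemma. [folklore] -/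
@[simp] theorem mem_pivotalPoints {S : QuadConfig D} {x : ℂ} :
    x ∈ S.pivotalPoints ↔ ∃ Q : Quad D, S.IsPivotalAt x Q :=
  Iff.rfl

/-- The complement of the pivotal set in the form inlined in (ADM). [folklore] -/
theorem compl_pivotalPoints (S : QuadConfig D) :
    (S.pivotalPoints)ᶜ = {x | ¬ ∃ Q : Quad D, S.IsPivotalAt x Q} :=
  rfl

/-- `pivotalPoints_none`: the empty configuration has no pivotal points. [folklore] -/
@[simp] theorem pivotalPoints_none : (none : QuadConfig D).pivotalPoints = ∅ :=
  eq_empty_of_forall_notMem fun x ⟨Q, hQ⟩ => not_isPivotalAt_none x Q hQ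

/-- **The toggled crossing pattern**: for a finite family of quads `Q`, the set of indices crossed
after flipping at `x` — `{i | Qᵢ ∈ S} Δ {i | Piv S x Qᵢ}`, written with `Xor` as in the items.
[cite: GarbanPeteSchramm2018, §7.1 (updating a configuration by flipping a pivotal point)] -/
def toggledPattern {n : ℕ} (S : QuadConfig D) (x : ℂ) (Q : Fin n → Quad D) : Set (Fin n) :=
  {i | Xor (Q i ∈ S) (S.IsPivotalAt x (Q i))}

/-- Off the pivotal set flipping changes nothing: the toggled pattern is the crossing pattern.
[folklore] -/
theorem toggledPattern_eq_of_not_mem {n : ℕ} {S : QuadConfig D} {x : ℂ} (Q : Fin n → Quad D)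
    (hx : x ∉ S.pivotalPoints) : S.toggledPattern x Q = {i | Q i ∈ S} := by
  ext i
  simp only [toggledPattern, mem_setOf_eq]
  have hi : ¬ S.IsPivotalAt x (Q i) := fun h => hx ⟨Q i, h⟩
  simp [Xor, hi]

end QuadConfig

/-! ### Flip-fair kernels: invariance of the Campbell measure under the pivotal involution -/

/-- **(F) — `K` is a flip-fair kernel for the law `P` on `ℋ_D`**: the Campbell measure
`P(dS) K(S)(dx)` is invariant under the pivotal involution `(S, x) ↦ (S^x, x)`, stated on
cylinder test functions `φ(x) · g({i | Qᵢ ∈ S})` (`φ` continuous with compact support, `Q` a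
finite family of quads, `g` any function of the crossing pattern): flipping at `x` replaces the
pattern `{i | Qᵢ ∈ S}` by `{i | Qᵢ ∈ S} Δ {i | x pivotal for Qᵢ}`.  For Garban–Pete–Schramm's
cut-off dynamics (flip the points of a Poisson process of intensity `μ^ε(ω)(dx) dt`, GPS 2018
§7.1) this is detailed balance — the reversibility of the dynamical scaling limit w.r.t. the
percolation scaling limit (GPS 2018 §11.1, Theorem) in the Campbell–Mecke form of Mecke 1967 /
Last–Penrose Thm. 4.1; verbatim clause (F) of route CardyMeckeFlip. [cite: GarbanPeteSchramm2018, §7.1 and §11.1 (reversibility of the dynamics driven by μ^ε)] -/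
def IsFlipFairKernel (P : Measure (QuadConfig D)) (K : QuadConfig D → Measure ℂ) : Prop :=
  ∀ (n : ℕ) (Q : Fin n → Quad D) (g : Set (Fin n) → ℝ) (φ : ℂ → ℝ), Continuous φ →
    HasCompactSupport φ →
      ∫ S, ∫ x, φ x * g {i | Q i ∈ S} ∂(K S) ∂P =
        ∫ S, ∫ x, φ x * g {i | Xor (Q i ∈ S) (S.IsPivotalAt x (Q i))} ∂(K S) ∂P

/-- `isFlipFairKernel_iff`: unfolding to the inlined clause (F). [folklore] -/
theorem isFlipFairKernel_iff (P : Measure (QuadConfig D)) (K : QuadConfig D → Measure ℂ) :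
    IsFlipFairKernel P K ↔
      ∀ (n : ℕ) (Q : Fin n → Quad D) (g : Set (Fin n) → ℝ) (φ : ℂ → ℝ), Continuous φ →
        HasCompactSupport φ →
          ∫ S, ∫ x, φ x * g {i | Q i ∈ S} ∂(K S) ∂P =
            ∫ S, ∫ x, φ x * g {i | Xor (Q i ∈ S) (S.IsPivotalAt x (Q i))} ∂(K S) ∂P :=
  Iff.rfl

/-- The zero law is flip-fair for every kernel. [folklore] -/
theorem isFlipFairKernel_zero_measure (K : QuadConfig D → Measure ℂ) :
    IsFlipFairKernel (0 : Measure (QuadConfig D)) K := by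
  intro n Q g φ _ _
  simp only [integral_zero_measure]

/-- The zero kernel is flip-fair for every law. [folklore] -/
theorem isFlipFairKernel_zero_kernel (P : Measure (QuadConfig D)) :
    IsFlipFairKernel P (fun _ => (0 : Measure ℂ)) := by
  intro n Q g φ _ _
  simp only [integral_zero_measure]

/-- Flip-fairness is homogeneous in the law (`P ↦ c • P`): the flip-fair laws for a fixed kernel
form a cone. (Additivity needs integrability of the cylinder functions against `P(dS)K(S)(dx)`,
which (ADM) provides; it is not asserted here.) [folklore] -/
theorem IsFlipFairKernel.smul_measure {P : Measure (QuadConfig D)} {K : QuadConfig D → Measure ℂ}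
    (h : IsFlipFairKernel P K) (c : ℝ≥0∞) : IsFlipFairKernel (c • P) K := by
  intro n Q g φ hφ hφc
  simp only [integral_smul_measure, h n Q g φ hφ hφc]

/-- Flip-fairness is homogeneous in the kernel (`K ↦ c • K`). [folklore] -/
theorem IsFlipFairKernel.smul_kernel {P : Measure (QuadConfig D)} {K : QuadConfig D → Measure ℂ}
    (h : IsFlipFairKernel P K) (c : ℝ≥0∞) : IsFlipFairKernel P (fun S => c • K S) := by
  intro n Q g φ hφ hφc
  simp only [integral_smul_measure, integral_smul, h n Q g φ hφ hφc]

/-- Flip-fairness only sees the kernel `P`-almost everywhere. [folklore] -/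
theorem isFlipFairKernel_congr_ae {P : Measure (QuadConfig D)} {K K' : QuadConfig D → Measure ℂ}
    (h : ∀ᵐ S ∂P, K S = K' S) : IsFlipFairKernel P K ↔ IsFlipFairKernel P K' := by
  have key : ∀ (n : ℕ) (Q : Fin n → Quad D) (g : Set (Fin n) → ℝ) (φ : ℂ → ℝ),
      (∫ S, ∫ x, φ x * g {i | Q i ∈ S} ∂(K S) ∂P =
          ∫ S, ∫ x, φ x * g {i | Q i ∈ S} ∂(K' S) ∂P) ∧
        (∫ S, ∫ x, φ x * g {i | Xor (Q i ∈ S) (S.IsPivotalAt x (Q i))} ∂(K S) ∂P =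
          ∫ S, ∫ x, φ x * g {i | Xor (Q i ∈ S) (S.IsPivotalAt x (Q i))} ∂(K' S) ∂P) :=
    fun n Q g φ =>
      ⟨integral_congr_ae (h.mono fun S hS => by simp only [hS]),
        integral_congr_ae (h.mono fun S hS => by simp only [hS])⟩
  constructor
  · intro hK n Q g φ hφ hφc
    rw [← (key n Q g φ).1, ← (key n Q g φ).2]
    exact hK n Q g φ hφ hφc
  · intro hK n Q g φ hφ hφc
    rw [(key n Q g φ).1, (key n Q g φ).2]
    exact hK n Q g φ hφ hφc

/-! ### Admissible kernel families and isometry-equivariance -/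

/-- **(ADM) — admissible pivotal kernel family** `M : ℝ → ℋ_D → Measure ℂ` (cutoff `ε ↦ M ε`)
for the law `P`: (1) each `M ε : ℋ_D → Measure ℂ` is measurable (Giry `σ`-algebra) — GPS's
"`μ^ε(ω)` is a measurable function of `ω`"; (2) antitone in the cutoff — lowering `ε` only adds
points (`Piv^{ε'} ⊇ Piv^ε`); (3) locally `P`-integrable — `E μ^ε(B) < ∞` for bounded `B`
(GPS 2018 Prop. 2.6-(i)); (4) `P`-a.s. supported on the pivotal points of `S`; (5) non-zero.
Verbatim the first five conjuncts of clause (ADM) of route CardyMeckeFlip; the sixth,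
isometry-equivariance, needs the action of plane isometries and is `IsIsometryEquivariant`
(`D = ℂ`). [cite: GarbanPeteSchramm2018, §2.6 (Cor. and Prop.: μ^ε measurable in ω, first moment bound)] -/
structure IsAdmissibleKernel (P : Measure (QuadConfig D)) (M : ℝ → QuadConfig D → Measure ℂ) :
    Prop where
  /-- (1) each cutoff kernel is a measurable map `ℋ_D → Measure ℂ` (Giry `σ`-algebra). -/
  measurable : ∀ ε : ℝ, Measurable (M ε)
  /-- (2) antitone in the cutoff: for `0 < ε' ≤ ε`, `M ε S ≤ M ε' S`. -/
  antitone : ∀ ε ε' : ℝ, 0 < ε' → ε' ≤ ε → ∀ S : QuadConfig D, M ε S ≤ M ε' S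
  /-- (3) locally `P`-integrable: finite expected mass of every ball. -/
  lintegral_closedBall_lt_top :
    ∀ ε : ℝ, 0 < ε → ∀ r : ℝ, ∫⁻ S, M ε S (Metric.closedBall 0 r) ∂P < ⊤
  /-- (4) `P`-a.s. supported on the pivotal points of the configuration. -/
  ae_apply_not_isPivotalAt :
    ∀ ε : ℝ, 0 < ε → ∀ᵐ S ∂P, M ε S {x | ¬ ∃ Q : Quad D, S.IsPivotalAt x Q} = 0
  /-- (5) non-zero: some cutoff kernel charges the unit ball with positive expected mass. -/
  exists_lintegral_ball_pos : ∃ ε : ℝ, 0 < ε ∧ 0 < ∫⁻ S, M ε S (Metric.ball 0 1) ∂P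

/-- **Isometry-equivariance** of a kernel family on the whole-plane space `ℋ_ℂ`: moving the
configuration by a plane isometry `g` moves the measure, `M ε (g · S) = g_* (M ε S)` — the last
conjunct of (ADM) (obtained for GPS's `μ^ε` by averaging the `ε`-grid over shifts and rotations,
GPS 2013 §1 p. 10 / §4.3). [cite: GarbanPeteSchramm2013Pivotal, §1 p. 10 (averaging over shifted and rotated grids)] -/
def IsIsometryEquivariant (M : ℝ → QuadConfig (univ : Set ℂ) → Measure ℂ) : Prop :=
  ∀ (g : ℂ ≃ᵢ ℂ) (ε : ℝ) (S : QuadConfig (univ : Set ℂ)),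
    M ε (QuadConfig.isometry g S) = Measure.map g (M ε S)

/-- The zero kernel family is isometry-equivariant (`g_* 0 = 0`). [folklore] -/
theorem isIsometryEquivariant_zero : IsIsometryEquivariant fun _ _ => (0 : Measure ℂ) :=
  fun _ _ _ => (Measure.map_zero _).symm

/-- `isAdmissibleKernel_iff`: unfolding to the first five conjuncts of (ADM). [folklore] -/
theorem isAdmissibleKernel_iff (P : Measure (QuadConfig D)) (M : ℝ → QuadConfig D → Measure ℂ) :
    IsAdmissibleKernel P M ↔
      (∀ ε : ℝ, Measurable (M ε)) ∧
        (∀ ε ε' : ℝ, 0 < ε' → ε' ≤ ε → ∀ S : QuadConfig D, M ε S ≤ M ε' S) ∧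
          (∀ ε : ℝ, 0 < ε → ∀ r : ℝ, ∫⁻ S, M ε S (Metric.closedBall 0 r) ∂P < ⊤) ∧
            (∀ ε : ℝ, 0 < ε → ∀ᵐ S ∂P, M ε S {x | ¬ ∃ Q : Quad D, S.IsPivotalAt x Q} = 0) ∧
              (∃ ε : ℝ, 0 < ε ∧ 0 < ∫⁻ S, M ε S (Metric.ball 0 1) ∂P) :=
  ⟨fun ⟨h₁, h₂, h₃, h₄, h₅⟩ => ⟨h₁, h₂, h₃, h₄, h₅⟩, fun ⟨h₁, h₂, h₃, h₄, h₅⟩ => ⟨h₁, h₂, h₃, h₄, h₅⟩⟩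

/-- **(ADM) verbatim**: on `ℋ_ℂ`, `IsAdmissibleKernel P M ∧ IsIsometryEquivariant M` is exactly the
six-clause conjunction inlined in items FlipIdentityZ2 / FlipErgodicityZ2 / MeckeRigidity (with
their parameter `Piv` read as `IsPivotalAt`). [folklore] -/
theorem isAdmissibleKernel_and_isIsometryEquivariant_iff (P : Measure (QuadConfig (univ : Set ℂ)))
    (M : ℝ → QuadConfig (univ : Set ℂ) → Measure ℂ) :
    IsAdmissibleKernel P M ∧ IsIsometryEquivariant M ↔
      ((∀ ε : ℝ, Measurable (M ε)) ∧
        (∀ ε ε' : ℝ, 0 < ε' → ε' ≤ ε → ∀ S : QuadConfig (univ : Set ℂ), M ε S ≤ M ε' S) ∧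
        (∀ ε : ℝ, 0 < ε → ∀ r : ℝ, ∫⁻ S, M ε S (Metric.closedBall 0 r) ∂P < ⊤) ∧
        (∀ ε : ℝ, 0 < ε → ∀ᵐ S ∂P,
          M ε S {x | ¬ ∃ Q : Quad (univ : Set ℂ), S.IsPivotalAt x Q} = 0) ∧
        (∃ ε : ℝ, 0 < ε ∧ 0 < ∫⁻ S, M ε S (Metric.ball 0 1) ∂P) ∧
        (∀ (g : ℂ ≃ᵢ ℂ) (ε : ℝ) (S : QuadConfig (univ : Set ℂ)),
          M ε (QuadConfig.isometry g S) = Measure.map g (M ε S))) :=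
  ⟨fun ⟨⟨h₁, h₂, h₃, h₄, h₅⟩, h₆⟩ => ⟨h₁, h₂, h₃, h₄, h₅, h₆⟩,
    fun ⟨h₁, h₂, h₃, h₄, h₅, h₆⟩ => ⟨⟨h₁, h₂, h₃, h₄, h₅⟩, h₆⟩⟩

/-- An admissible kernel family charges no non-pivotal point: a.s. `M ε S (pivotalPoints S)ᶜ = 0`
(clause (4) in the `pivotalPoints` spelling). [folklore] -/
theorem IsAdmissibleKernel.ae_compl_pivotalPoints {P : Measure (QuadConfig D)}
    {M : ℝ → QuadConfig D → Measure ℂ} (h : IsAdmissibleKernel P M) {ε : ℝ} (hε : 0 < ε) :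
    ∀ᵐ S ∂P, M ε S (S.pivotalPoints)ᶜ = 0 :=
  h.ae_apply_not_isPivotalAt ε hε

/-! ### Flip-extremality (flip-ergodicity) -/

/-- **(EXT) — `P` is flip-extremal for the kernel family `M`**: `P` is an extreme point, in
midpoint form, of the convex set of probability laws on `ℋ_D` that are flip-fair for every cutoff
kernel `M ε`, `ε > 0`: whenever two such laws average to `P` (`P₁ + P₂ = P + P`), `P₁ = P`.  The
items call this flip-ergodicity (for a reversible Markov dynamics, extremality among stationary
laws is ergodicity; whether the dynamical percolation scaling limit is ergodic is OPEN, GPS 2018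
§12.1 Remark).  Verbatim clause (EXT) of route CardyMeckeFlip. [cite: GarbanPeteSchramm2018, §12.1 (Remark: ergodicity of the dynamical scaling limit)] -/
def IsFlipExtremal (P : Measure (QuadConfig D)) (M : ℝ → QuadConfig D → Measure ℂ) : Prop :=
  ∀ P₁ P₂ : Measure (QuadConfig D), IsProbabilityMeasure P₁ → IsProbabilityMeasure P₂ →
    (∀ ε : ℝ, 0 < ε → IsFlipFairKernel P₁ (M ε)) → (∀ ε : ℝ, 0 < ε → IsFlipFairKernel P₂ (M ε)) →
      P₁ + P₂ = P + P → P₁ = P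

/-- `isFlipExtremal_iff`: unfolding to clause (EXT) with (F) inlined, as in the items. [folklore] -/
theorem isFlipExtremal_iff (P : Measure (QuadConfig D)) (M : ℝ → QuadConfig D → Measure ℂ) :
    IsFlipExtremal P M ↔
      ∀ P₁ P₂ : Measure (QuadConfig D), IsProbabilityMeasure P₁ → IsProbabilityMeasure P₂ →
        (∀ ε : ℝ, 0 < ε → ∀ (n : ℕ) (Q : Fin n → Quad D) (g : Set (Fin n) → ℝ) (φ : ℂ → ℝ),
          Continuous φ → HasCompactSupport φ →
            ∫ S, ∫ x, φ x * g {i | Q i ∈ S} ∂(M ε S) ∂P₁ =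
              ∫ S, ∫ x, φ x * g {i | Xor (Q i ∈ S) (S.IsPivotalAt x (Q i))} ∂(M ε S) ∂P₁) →
        (∀ ε : ℝ, 0 < ε → ∀ (n : ℕ) (Q : Fin n → Quad D) (g : Set (Fin n) → ℝ) (φ : ℂ → ℝ),
          Continuous φ → HasCompactSupport φ →
            ∫ S, ∫ x, φ x * g {i | Q i ∈ S} ∂(M ε S) ∂P₂ =
              ∫ S, ∫ x, φ x * g {i | Xor (Q i ∈ S) (S.IsPivotalAt x (Q i))} ∂(M ε S) ∂P₂) →
          P₁ + P₂ = P + P → P₁ = P :=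
  Iff.rfl

/-- In (EXT) the second law is flip-extremal data too: by symmetry of the midpoint condition,
`P₂ = P` as well. [folklore] -/
theorem IsFlipExtremal.eq_right {P : Measure (QuadConfig D)} {M : ℝ → QuadConfig D → Measure ℂ}
    (h : IsFlipExtremal P M) {P₁ P₂ : Measure (QuadConfig D)} [IsProbabilityMeasure P₁]
    [IsProbabilityMeasure P₂] (h₁ : ∀ ε : ℝ, 0 < ε → IsFlipFairKernel P₁ (M ε))
    (h₂ : ∀ ε : ℝ, 0 < ε → IsFlipFairKernel P₂ (M ε)) (hsum : P₁ + P₂ = P + P) : P₂ = P :=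
  h P₂ P₁ inferInstance inferInstance h₂ h₁ (by rwa [add_comm])

end QuadCrossing

end Literature.Probability.Percolation
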